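import Summits.HodgeConjecture.HodgeConjecture.Theorems.F0P3cStCharTSShellKit           -- ★ (this seat) the shell kit: «MULT-ARTIN», «TORUS-GEN» (CM), dominance, shell trace, eigen-functional ⇒ T-map
import Summits.HodgeConjecture.HodgeConjecture.Theorems.F0P3bQCMTSignedOfSteinberg       -- ★ the P3b line's cone (every notion of the organ's binders: `finExplicitCollection`, `quadraticHeckeCharCM`, …)
import Summits.HodgeConjecture.HodgeConjecture.Theorems.F0P3cStCharTSPi2Id               -- ★ p848179 «PI2-ID» `eq_pi2_of_isSquareIntegrable_of_quotientCharacter`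
import Summits.HodgeConjecture.HodgeConjecture.Theorems.F0P3cStCharTSTorusMultiset       -- ★ p848271 «TMULT» `exists_multiset_of_finrank_le_two`
import Summits.HodgeConjecture.HodgeConjecture.Theorems.F0P3cStCharTSJacquetLine         -- ★ p848367 «JDIM2» `finrank_coinvariants_le_two`
import Summits.HodgeConjecture.HodgeConjecture.Theorems.F0P3LocalIrrepAdmissibleOfCuspidal  -- ★ `isAdmissible_irrClass_quasiSplit_of_cuspidal`
import Summits.HodgeConjecture.HodgeConjecture.Theorems.F0P3LocalIrrepAdmissibleThree     -- ★ `isSupercuspidal_of_subsingleton_coinvariants`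
import Literature.NumberTheory.Automorphic.DoubleCosetHaarVolume                         -- ★ `DoubleCosetIndex.isCompact_doubleCoset`
import Literature.NumberTheory.Rogawski1990.LocalTransferExistence                       -- ★ `IsLocalDeltaTransferExists` ((T_v))
import Literature.NumberTheory.Rogawski1990.LocalTransferFundamentalLemma                -- ★ `IsLocSmooth`, `isLocSmooth_indicator`
import HarnessLib

/-!
# F0 · P3c · line LH6 «StCharTS» — ORGAN (S-i) `stub_StNoncuspidalMember` OVER THE RESIDUAL NAMED INPUT «XIG»:
# `aX(π²(ξ_v)) = 1` in the two-point identity of [Rogawski1990, Lemma 12.7.3 p. 195], by the SHELL ROAD (Casselman)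

Cell `hodgecm-mathlib`, squad F0∕P3b → line LH6 (P3c), seat LH6-p02 (g0); deal F0P3b-plan (g23) 02:21:26Z, road «=» 02:40Z, XIG St-form «=» LH6-p04 03:03:25Z
+ depth amendment «=» 03:04:33Z.  THEOREMS lane, sorry-free, `--supports stmt-HodgeConjecture-24833 --as helper`; count-neutral.

WHAT.  `stNoncuspidalMember_of_XIG (hXIG) : ‹type of stub_StNoncuspidalMember of Cruxes/H413/Lines/F0_P3c_StCharTSPaydown.lean ED. 1 :297–:347, verbatim
(reducible abbreviations `Pl`∕`HLoc` spelled out)›`.  The hypothesis `hXIG` («XIG-St» = [Rogawski1990, L.12.7.3 proof p. 195 display ⟸ Prop. 12.5.1 p. 183 +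
p. 193] + the shell hypothesis) is the ONE residual named input of the organ: under the organ's prefix, for every Iwahori datum `𝓘` of ★ `cmBorelTriple L 3 v` whose
ray `𝓘.a` reads `d(α, 1, (σ_w α)⁻¹)` (`0 < |α|_w < 1`) in the one-place model, every central `z`, all deep levels `K_n` and `m ≥ 1`: a smooth `f^H` matched
(Δ‴) with the shell `𝟙_{K_n (z·𝓘.aᵐ) K_n}` has `Tr St_H(ξ_v)(f^H) = ν(K_n) · [K_n : K_n ∩ ᵇK_n] · δ_B^{1/2}(b) · χ_ξ(b)`, `b = z·𝓘.aᵐ` — print's evaluation of the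
`H`-side through the character identity of Prop. 12.5.1 and the germ of `St_H` (road (D), LH6-p04, multi-session).

PROOF ROAD (B6, kernel-checked here).  Let `πp ≠ πm` carry `aX = +1, −1`.  (1) Both are admissible (★ N3 on `U(Φ₃)`), with Jacquet modules of dimension `≤ 2`
(★ «JDIM2»), so `tr π_N(·)` on each is a sum of `≤ 2` characters of `T` with attached quotient functionals (★ «TMULT»).  (2) For `b = z·a` (`z` central, `a` a
contracting ray) the (T1) package ★ `exists_cmIwahoriDatum` + ★ R2d `smoothTrace_indicator_shell_eq` + ★ «LEVEL-DEPTH» give `Tr π(𝟙_{K b K}) = ν(K)·#R·tr π_N(b)`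
at deep level, while (β) (`hid`, two-point support) and «XIG» give `Tr πp − Tr πm = ν(K)·#R·(δ^{1/2}χ_ξ)(b)`; cancelling, `Σ_{s_p} θ(b) − Σ_{s_m} θ(b) = (δ^{1/2}χ_ξ)(b)`
on the subsemigroup `B = Z(G)·{rays}` of `T`.  (3) `B` generates `T` (★ «TORUS-GEN» pulled back along ★ `localNonsplitEquiv`, §2), so Artin (★ «ARTIN-B») forces
`δ^{1/2}χ_ξ ∈ s_p`; its quotient functional, renormalised by `δ^{-1/2}` (★ `normalizedJacquet_apply`), is a non-zero `T`-map `r_B(πp) → ℂ_{χ_ξ}`, whence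
`πp = π²` by ★ «PI2-ID» (Frobenius + Keys), i.e. `aX π² = 1`.
HONEST LABEL: conditional on «XIG» (named, vetted, owned by LH6-p04's road (D)); HC_CM is proved only modulo the 7 printed citations (2 remaining: hLiu418 =
stmt-HodgeConjecture-24832, h413 = stmt-HodgeConjecture-24833) until rung 0 closes.

## References
* [Rogawski1990] J. D. Rogawski, *Automorphic Representations of Unitary Groups in Three Variables*, Ann. of Math. Stud. 123 (1990), §12.5 Prop. 12.5.1
  p. 183, §12.7 Lemma 12.7.3 p. 195, p. 193.
* [Casselman1977] W. Casselman, *Characters and Jacquet modules*, Math. Ann. 230 (1977) 101–105, Thm. 5.2.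
* [Casselman1995] W. Casselman, *Introduction to the theory of admissible representations of p-adic reductive groups* (1995 notes), §3.3, §4.1.
* [BernsteinZelevinsky1977] I. N. Bernstein, A. V. Zelevinsky, *Induced representations of reductive p-adic groups I*, Ann. Sci. ÉNS 10 (1977), 2.9.
-/

set_option autoImplicit false
set_option linter.dupNamespace false

noncomputable section

open NumberField IsDedekindDomain MeasureTheory
open scoped Matrix MatrixGroups WithZero Topology Pointwise
open Literature.NumberTheory Literature.NumberTheory.Automorphic Literature.NumberTheory.Automorphic.UnitaryGroup
open Literature.NumberTheory.GaloisRepresentations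
open Literature.NumberTheory.Rogawski1990

namespace Summit.HodgeConjecture.HodgeConjecture.Cruxes.H413.F0P3cStCharTSNoncuspidalOfXIG

/-! ## §4 The organ (S-i) over «XIG» -/

section Organ

set_option maxHeartbeats 4000000 in  -- statement-level `whnf` on the CM carriers (two copies of the organ prefix) + the long composition
set_option synthInstance.maxHeartbeats 400000 in
/-- **ORGAN (S-i) `stub_StNoncuspidalMember` OVER THE RESIDUAL NAMED INPUT «XIG»** — [Rogawski1990, Lemma 12.7.3 p. 195] on `U(Φ₃)(L⁺_v)`: in the two-point
identity of (β) with coefficients `(1, −1)` on a square-integrable pair, the `+1` member is Keys' `π²(ξ_v)`, i.e. `aX(π²) = 1`.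
HYPOTHESIS `hXIG` («XIG-St»): under the organ's own prefix (verbatim through `hπ₁`), for every Iwahori datum `𝓘` of ★ `cmBorelTriple L 3 v` whose ray reads
`d(α, 1, (σ_w α)⁻¹)`, `0 < |α|_w < 1`, in the one-place model, every central `z`, there is a depth neighbourhood `U ∋ 1` such that at every level `K_n ⊆ U`,
every `m ≥ 1`, every left transversal `R` of `K_n ∕ (K_n ∩ ᵇK_n)` (`b = z·𝓘.aᵐ`) and every smooth `f^H` Δ‴-matched with the shell `𝟙_{K_n b K_n}`:
`Tr πSt(f^H) = ν(K_n) · #R · δ_B^{1/2}(b) · χ_ξ(b)` — print's «`D_G(γ)χ^G_ρ(γ) = ξ(γ)μ(α)‖α‖^{1/2}` by Proposition 12.5.1» for `ρ = St_H(ξ)` [p. 195 ⟸ Prop. 12.5.1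
p. 183 + p. 193], read on the shells; owned by LH6-p04's road (D) (deep fundamental lemma on the hyperbolic set), vetted «=» 03:03:25Z.
CONCLUSION: the type of `stub_StNoncuspidalMember` (tree `Cruxes/H413/Lines/F0_P3c_StCharTSPaydown.lean` ED. 1 :297–:347) verbatim, its reducible
abbreviations `Pl`∕`HLoc` spelled out.  Proof = ★ shell kit `F0P3cStCharTSShellKit` (§§1–3 there) + ★ (T1) + ★ R2d + ★ «LEVEL-DEPTH» + ★ «JDIM2» + ★ «TMULT» + ★ «ARTIN-B» + ★ «PI2-ID» (module docstring).
[cite: Rogawski1990, Lemma 12.7.3 p. 195; Prop. 12.5.1 p. 183; §12.7 p. 193; §4.9 Prop. 4.9.1 (a) p. 55] [cite: Casselman1977, Thm. 5.2]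
[cite: BernsteinZelevinsky1977, Thm. 2.9] -/
theorem stNoncuspidalMember_of_XIG
    (hXIG :
      ∀ (L : Type) [Field L] [NumberField L] [IsCMField L] (μ : HeckeCharacter L) (ξ : OneDimAutRepH L) (v : HeightOneSpectrum (𝓞 ↥(maximalRealSubfield L))),
        (∀ w : PlacesOver L v, IsCMField.complexConj L • w.1 = w.1) → μ.IsUnitary →
        (∀ x : Literature.NumberTheory.GaloisRepresentations.ideleGroup ↥(maximalRealSubfield L),
          μ (AdeleRing.ideleBaseChange (↥(maximalRealSubfield L)) L x) = quadraticHeckeCharCM L x) →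
        ∀ [MeasurableSpace (((UnitaryGroup.cmDatum L 2 (Matrix.of fun i j : Fin 2 => if i.val + j.val + 1 = 2 then (1 : L) else 0)).Local v × (UnitaryGroup.cmDatum L 1 (Matrix.of fun i j : Fin 1 => if i.val + j.val + 1 = 1 then (1 : L) else 0)).Local v))] [BorelSpace (((UnitaryGroup.cmDatum L 2 (Matrix.of fun i j : Fin 2 => if i.val + j.val + 1 = 2 then (1 : L) else 0)).Local v × (UnitaryGroup.cmDatum L 1 (Matrix.of fun i j : Fin 1 => if i.val + j.val + 1 = 1 then (1 : L) else 0)).Local v))] [MeasurableSpace (Gqs L v)] [BorelSpace (Gqs L v)]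
          (νHv : Measure (((UnitaryGroup.cmDatum L 2 (Matrix.of fun i j : Fin 2 => if i.val + j.val + 1 = 2 then (1 : L) else 0)).Local v × (UnitaryGroup.cmDatum L 1 (Matrix.of fun i j : Fin 1 => if i.val + j.val + 1 = 1 then (1 : L) else 0)).Local v))) (νQv : Measure (Gqs L v))
          [νHv.IsHaarMeasure] [νHv.IsMulRightInvariant] [νQv.IsHaarMeasure] [νQv.IsMulRightInvariant],
        letI : ∀ a : ((UnitaryGroup.cmDatum L 2 (Matrix.of fun i j : Fin 2 => if i.val + j.val + 1 = 2 then (1 : L) else 0)).Local v × (UnitaryGroup.cmDatum L 1 (Matrix.of fun i j : Fin 1 => if i.val + j.val + 1 = 1 then (1 : L) else 0)).Local v), MeasurableSpace (((UnitaryGroup.cmDatum L 2 (Matrix.of fun i j : Fin 2 => if i.val + j.val + 1 = 2 then (1 : L) else 0)).Local v × (UnitaryGroup.cmDatum L 1 (Matrix.of fun i j : Fin 1 => if i.val + j.val + 1 = 1 then (1 : L) else 0)).Local v) ⧸ Subgroup.centralizer ({a} : Set (((UnitaryGroup.cmDatum L 2 (Matrix.of fun i j : Fin 2 => if i.val + j.val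 + 1 = 2 then (1 : L) else 0)).Local v × (UnitaryGroup.cmDatum L 1 (Matrix.of fun i j : Fin 1 => if i.val + j.val + 1 = 1 then (1 : L) else 0)).Local v)))) := fun _ => borel _
        haveI : ∀ a : ((UnitaryGroup.cmDatum L 2 (Matrix.of fun i j : Fin 2 => if i.val + j.val + 1 = 2 then (1 : L) else 0)).Local v × (UnitaryGroup.cmDatum L 1 (Matrix.of fun i j : Fin 1 => if i.val + j.val + 1 = 1 then (1 : L) else 0)).Local v), BorelSpace (((UnitaryGroup.cmDatum L 2 (Matrix.of fun i j : Fin 2 => if i.val + j.val + 1 = 2 then (1 : L) else 0)).Local v × (UnitaryGroup.cmDatum L 1 (Matrix.of fun i j : Fin 1 => if i.val + j.val + 1 = 1 then (1 : L) else 0)).Local v) ⧸ Subgroup.centralizer ({a} : Set (((UnitaryGroup.cmDatum L 2 (Matrix.of fun i j : Fin 2 => if i.val + j.val + 1 = 2 then (1 : L) else 0)).Local v × (UnitaryGroup.cmDatum L 1 (Matrix.of fun i j : Fin 1 => if i.val + j.val + 1 = 1 then (1 : L) else 0)).Local v)))) := fun _ => ⟨rfl⟩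
        letI : ∀ γ : Gqs L v, MeasurableSpace (Gqs L v ⧸ Subgroup.centralizer ({γ} : Set (Gqs L v))) := fun _ => borel _
        haveI : ∀ γ : Gqs L v, BorelSpace (Gqs L v ⧸ Subgroup.centralizer ({γ} : Set (Gqs L v))) := fun _ => ⟨rfl⟩
        ∀ (mHv : OrbitalMeasureFamily (((UnitaryGroup.cmDatum L 2 (Matrix.of fun i j : Fin 2 => if i.val + j.val + 1 = 2 then (1 : L) else 0)).Local v × (UnitaryGroup.cmDatum L 1 (Matrix.of fun i j : Fin 1 => if i.val + j.val + 1 = 1 then (1 : L) else 0)).Local v))) (mQv : OrbitalMeasureFamily (Gqs L v)),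
          mHv.IsCanonical (IsLocalGRegular L v) νHv →
          mQv.IsCanonical (fun γ => IsRegularElt (γ.val : GL (Fin 3) (UnitaryGroup.LocalRing L v))) νQv →
          IsLocalDeltaTransferExists L (qsForm L) v ((finExplicitCollection L (qsForm L) μ (finExplicitDelta_conj_left_all L (qsForm L) μ) (finExplicitDelta_conj_right_all L (qsForm L) μ)) v) mHv mQv IsLocSmooth IsLocSmooth →
          ∀ (π₁ πSt : IrrClass (((UnitaryGroup.cmDatum L 2 (Matrix.of fun i j : Fin 2 => if i.val + j.val + 1 = 2 then (1 : L) else 0)).Local v × (UnitaryGroup.cmDatum L 1 (Matrix.of fun i j : Fin 1 => if i.val + j.val + 1 = 1 then (1 : L) else 0)).Local v))),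
            HLengthTwoLabels L v
              (torusCharPair (conjLocal L (IsCMField.complexConj L) v) (cmLocalForm L 2 v) (cmLocalForm_eq_over L 2 v) 0
                ((torusLocalComponent L (IsCMField.complexConj L) v ξ.η).comp
                    (quotConj (conjLocal L (IsCMField.complexConj L) v) (conjLocal_conjLocal_cm L v)) *
                  halfModulusChar (UnitaryGroup.LocalRing L v))
                (torusLocalComponent L (IsCMField.complexConj L) v ξ.ψ))
              ((torusLocalComponent L (IsCMField.complexConj L) v ξ.ψ).comp (localDet (IsCMField.complexConj L) v (isUnit_antidiagOne_det L 1))) π₁ πSt →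
            (∀ fH : ((UnitaryGroup.cmDatum L 2 (Matrix.of fun i j : Fin 2 => if i.val + j.val + 1 = 2 then (1 : L) else 0)).Local v × (UnitaryGroup.cmDatum L 1 (Matrix.of fun i j : Fin 1 => if i.val + j.val + 1 = 1 then (1 : L) else 0)).Local v) → ℂ, IsLocSmooth fH → π₁.smoothTrace νHv fH = charDist (ξ.xiLocalChar v) νHv fH) →
          haveI := locallyCompactSpace_cmBorelU L 3 v
          ∀ (𝓘 : (cmBorelTriple L 3 v).IwahoriDatum) (z : ↥(unitaryGroupOfForm (conjLocal L (IsCMField.complexConj L) v) (cmLocalForm L 3 v))),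
            z ∈ Subgroup.center ↥(unitaryGroupOfForm (conjLocal L (IsCMField.complexConj L) v) (cmLocalForm L 3 v)) →
          ∀ (w : PlacesOver L v) (hw : IsCMField.complexConj L • w.1 = w.1) (α : w.1.adicCompletion L), α ≠ 0 → Valued.v α < 1 →
            ((((localNonsplitEquiv (IsCMField.complexConj L) (Rogawski1990.qsForm L) (IsCMField.complexConj_ne_one L) w hw) 𝓘.a : ↥(unitaryGroupOfForm (galAdicCompletionMap (L := L) (IsCMField.complexConj L) hw) (placeForm (Rogawski1990.qsForm L) w.1))) :
                GL (Fin 3) (w.1.adicCompletion L)) : Matrix (Fin 3) (Fin 3) (w.1.adicCompletion L)) = Matrix.diagonal ![α, 1, ((galAdicCompletionMap (L := L) (IsCMField.complexConj L) hw) α)⁻¹] →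
            ∃ U ∈ 𝓝 (1 : ↥(unitaryGroupOfForm (conjLocal L (IsCMField.complexConj L) v) (cmLocalForm L 3 v))), ∀ n : ℕ, ((𝓘.K n : Set ↥(unitaryGroupOfForm (conjLocal L (IsCMField.complexConj L) v) (cmLocalForm L 3 v))) ⊆ U) → ∀ m : ℕ, 1 ≤ m →
              ∀ (hbM : z * 𝓘.a ^ m ∈ (cmBorelTriple L 3 v).M) (R : Finset ↥(unitaryGroupOfForm (conjLocal L (IsCMField.complexConj L) v) (cmLocalForm L 3 v))),
                IsLeftTransversal (𝓘.K n) (𝓘.K n ⊓ ConjAct.toConjAct (z * 𝓘.a ^ m) • 𝓘.K n) R →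
                ∀ fH : ((UnitaryGroup.cmDatum L 2 (Matrix.of fun i j : Fin 2 => if i.val + j.val + 1 = 2 then (1 : L) else 0)).Local v × (UnitaryGroup.cmDatum L 1 (Matrix.of fun i j : Fin 1 => if i.val + j.val + 1 = 1 then (1 : L) else 0)).Local v) → ℂ, IsLocSmooth fH →
                  IsLocalDeltaTransfer L (qsForm L) v ((finExplicitCollection L (qsForm L) μ (finExplicitDelta_conj_left_all L (qsForm L) μ) (finExplicitDelta_conj_right_all L (qsForm L) μ)) v) mHv mQv fH
                    ((DoubleCoset.doubleCoset (z * 𝓘.a ^ m) (𝓘.K n : Set ↥(unitaryGroupOfForm (conjLocal L (IsCMField.complexConj L) v) (cmLocalForm L 3 v))) (𝓘.K n)).indicator fun _ => (1 : ℂ)) →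
                  πSt.smoothTrace νHv fH =
                    (νQv.real (𝓘.K n : Set ↥(unitaryGroupOfForm (conjLocal L (IsCMField.complexConj L) v) (cmLocalForm L 3 v))) : ℂ) * (R.card : ℂ) *
                      ((rootDeltaChar (cmBorelTriple L 3 v).P (Subgroup.inclusion (cmBorelTriple L 3 v).M_le ⟨z * 𝓘.a ^ m, hbM⟩) : ℂˣ) : ℂ) *
                      (((cmXiTorusChar L v (μ.semilocalComponent L v) (torusLocalComponent L (IsCMField.complexConj L) v ξ.η) (torusLocalComponent L (IsCMField.complexConj L) v ξ.ψ)) ⟨z * 𝓘.a ^ m, hbM⟩ : ℂˣ) : ℂ)) :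
  ∀ (L : Type) [Field L] [NumberField L] [IsCMField L] (μ : HeckeCharacter L) (ξ : OneDimAutRepH L) (v : HeightOneSpectrum (𝓞 ↥(maximalRealSubfield L))),
    (∀ w : PlacesOver L v, IsCMField.complexConj L • w.1 = w.1) → μ.IsUnitary →
    (∀ x : Literature.NumberTheory.GaloisRepresentations.ideleGroup ↥(maximalRealSubfield L),
      μ (AdeleRing.ideleBaseChange (↥(maximalRealSubfield L)) L x) = quadraticHeckeCharCM L x) →
    ∀ [MeasurableSpace (((UnitaryGroup.cmDatum L 2 (Matrix.of fun i j : Fin 2 => if i.val + j.val + 1 = 2 then (1 : L) else 0)).Local v × (UnitaryGroup.cmDatum L 1 (Matrix.of fun i j : Fin 1 => if i.val + j.val + 1 = 1 then (1 : L) else 0)).Local v))] [BorelSpace (((UnitaryGroup.cmDatum L 2 (Matrix.of fun i j : Fin 2 => if i.val + j.val + 1 = 2 then (1 : L) else 0)).Local v × (UnitaryGroup.cmDatum L 1 (Matrix.of fun i j : Fin 1 => if i.val + j.val + 1 = 1 then (1 : L) else 0)).Local v))] [MeasurableSpace (Gqs L v)] [BorelSpace (Gqs L v)]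
      (νHv : Measure (((UnitaryGroup.cmDatum L 2 (Matrix.of fun i j : Fin 2 => if i.val + j.val + 1 = 2 then (1 : L) else 0)).Local v × (UnitaryGroup.cmDatum L 1 (Matrix.of fun i j : Fin 1 => if i.val + j.val + 1 = 1 then (1 : L) else 0)).Local v))) (νQv : Measure (Gqs L v))
      [νHv.IsHaarMeasure] [νHv.IsMulRightInvariant] [νQv.IsHaarMeasure] [νQv.IsMulRightInvariant],
    letI : ∀ a : ((UnitaryGroup.cmDatum L 2 (Matrix.of fun i j : Fin 2 => if i.val + j.val + 1 = 2 then (1 : L) else 0)).Local v × (UnitaryGroup.cmDatum L 1 (Matrix.of fun i j : Fin 1 => if i.val + j.val + 1 = 1 then (1 : L) else 0)).Local v), MeasurableSpace (((UnitaryGroup.cmDatum L 2 (Matrix.of fun i j : Fin 2 => if i.val + j.val + 1 = 2 then (1 : L) else 0)).Local v × (UnitaryGroup.cmDatum L 1 (Matrix.of fun i j : Fin 1 => if i.val + j.val + 1 = 1 then (1 : L) else 0)).Local v) ⧸ Subgroup.centralizer ({a} : Set (((UnitaryGroup.cmDatum L 2 (Matrix.of fun i j : Fin 2 => if i.val + j.val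 + 1 = 2 then (1 : L) else 0)).Local v × (UnitaryGroup.cmDatum L 1 (Matrix.of fun i j : Fin 1 => if i.val + j.val + 1 = 1 then (1 : L) else 0)).Local v)))) := fun _ => borel _
    haveI : ∀ a : ((UnitaryGroup.cmDatum L 2 (Matrix.of fun i j : Fin 2 => if i.val + j.val + 1 = 2 then (1 : L) else 0)).Local v × (UnitaryGroup.cmDatum L 1 (Matrix.of fun i j : Fin 1 => if i.val + j.val + 1 = 1 then (1 : L) else 0)).Local v), BorelSpace (((UnitaryGroup.cmDatum L 2 (Matrix.of fun i j : Fin 2 => if i.val + j.val + 1 = 2 then (1 : L) else 0)).Local v × (UnitaryGroup.cmDatum L 1 (Matrix.of fun i j : Fin 1 => if i.val + j.val + 1 = 1 then (1 : L) else 0)).Local v) ⧸ Subgroup.centralizer ({a} : Set (((UnitaryGroup.cmDatum L 2 (Matrix.of fun i j : Fin 2 => if i.val + j.val + 1 = 2 then (1 : L) else 0)).Local v × (UnitaryGroup.cmDatum L 1 (Matrix.of fun i j : Fin 1 => if i.val + j.val + 1 = 1 then (1 : L) else 0)).Local v)))) := fun _ => ⟨rfl⟩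
    letI : ∀ γ : Gqs L v, MeasurableSpace (Gqs L v ⧸ Subgroup.centralizer ({γ} : Set (Gqs L v))) := fun _ => borel _
    haveI : ∀ γ : Gqs L v, BorelSpace (Gqs L v ⧸ Subgroup.centralizer ({γ} : Set (Gqs L v))) := fun _ => ⟨rfl⟩
    ∀ (mHv : OrbitalMeasureFamily (((UnitaryGroup.cmDatum L 2 (Matrix.of fun i j : Fin 2 => if i.val + j.val + 1 = 2 then (1 : L) else 0)).Local v × (UnitaryGroup.cmDatum L 1 (Matrix.of fun i j : Fin 1 => if i.val + j.val + 1 = 1 then (1 : L) else 0)).Local v))) (mQv : OrbitalMeasureFamily (Gqs L v)),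
      mHv.IsCanonical (IsLocalGRegular L v) νHv →
      mQv.IsCanonical (fun γ => IsRegularElt (γ.val : GL (Fin 3) (UnitaryGroup.LocalRing L v))) νQv →
      IsLocalDeltaTransferExists L (qsForm L) v ((finExplicitCollection L (qsForm L) μ (finExplicitDelta_conj_left_all L (qsForm L) μ) (finExplicitDelta_conj_right_all L (qsForm L) μ)) v) mHv mQv IsLocSmooth IsLocSmooth →
      ∀ (π₁ πSt : IrrClass (((UnitaryGroup.cmDatum L 2 (Matrix.of fun i j : Fin 2 => if i.val + j.val + 1 = 2 then (1 : L) else 0)).Local v × (UnitaryGroup.cmDatum L 1 (Matrix.of fun i j : Fin 1 => if i.val + j.val + 1 = 1 then (1 : L) else 0)).Local v))),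
        HLengthTwoLabels L v
          (torusCharPair (conjLocal L (IsCMField.complexConj L) v) (cmLocalForm L 2 v) (cmLocalForm_eq_over L 2 v) 0
            ((torusLocalComponent L (IsCMField.complexConj L) v ξ.η).comp
                (quotConj (conjLocal L (IsCMField.complexConj L) v) (conjLocal_conjLocal_cm L v)) *
              halfModulusChar (UnitaryGroup.LocalRing L v))
            (torusLocalComponent L (IsCMField.complexConj L) v ξ.ψ))
          ((torusLocalComponent L (IsCMField.complexConj L) v ξ.ψ).comp (localDet (IsCMField.complexConj L) v (isUnit_antidiagOne_det L 1))) π₁ πSt →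
        (∀ fH : ((UnitaryGroup.cmDatum L 2 (Matrix.of fun i j : Fin 2 => if i.val + j.val + 1 = 2 then (1 : L) else 0)).Local v × (UnitaryGroup.cmDatum L 1 (Matrix.of fun i j : Fin 1 => if i.val + j.val + 1 = 1 then (1 : L) else 0)).Local v) → ℂ, IsLocSmooth fH → π₁.smoothTrace νHv fH = charDist (ξ.xiLocalChar v) νHv fH) →
      ∀ [MeasurableSpace (Gqs L v ⧸ Subgroup.center (Gqs L v))] [BorelSpace (Gqs L v ⧸ Subgroup.center (Gqs L v))]
        (μZ : Measure (Gqs L v ⧸ Subgroup.center (Gqs L v))) [μZ.IsHaarMeasure],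
      ∀ aX : IrrClass (Gqs L v) → ℤ,
        (∀ (fH : ((UnitaryGroup.cmDatum L 2 (Matrix.of fun i j : Fin 2 => if i.val + j.val + 1 = 2 then (1 : L) else 0)).Local v × (UnitaryGroup.cmDatum L 1 (Matrix.of fun i j : Fin 1 => if i.val + j.val + 1 = 1 then (1 : L) else 0)).Local v) → ℂ) (φ : Gqs L v → ℂ), IsLocSmooth fH → IsLocSmooth φ →
            IsLocalDeltaTransfer L (qsForm L) v ((finExplicitCollection L (qsForm L) μ (finExplicitDelta_conj_left_all L (qsForm L) μ) (finExplicitDelta_conj_right_all L (qsForm L) μ)) v) mHv mQv fH φ →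
            Summable (fun π : IrrClass (Gqs L v) => (aX π : ℂ) * π.smoothTrace νQv φ) ∧
              ∑' π : IrrClass (Gqs L v), (aX π : ℂ) * π.smoothTrace νQv φ = πSt.smoothTrace νHv fH) →
        ∀ (πp πm : IrrClass (Gqs L v)), πp ≠ πm → Function.support aX = {πp, πm} → aX πp = 1 → aX πm = -1 →
        (∀ π : IrrClass (Gqs L v), aX π ≠ 0 → π.IsSquareIntegrable μZ) →
      ∀ (π2 πn : IrrClass (Gqs L v)),
        KeysCaseTwoLabels L v (μ.semilocalComponent L v) (torusLocalComponent L (IsCMField.complexConj L) v ξ.η)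
          (torusLocalComponent L (IsCMField.complexConj L) v ξ.ψ) π2 πn →
        ¬ πn.IsSquareIntegrable μZ →
        aX π2 = 1 := by
  intro L _ _ _ μ ξ v hns hμu hμω _ _ _ _ νHv νQv _ _ _ _ mHv mQv hcH hcQ hTv π₁ πSt hlab hπ₁ _ _ μZ _ aX hid πp πm hne hsupp hp1 hm1 hsq π2 πn
    hK hL2
  -- the statement's Borel structures on the centraliser quotients, re-declared for instance search (as in the leaf's `QST_of_organs`)
  letI : ∀ a' : ((UnitaryGroup.cmDatum L 2 (Matrix.of fun i j : Fin 2 => if i.val + j.val + 1 = 2 then (1 : L) else 0)).Local v × (UnitaryGroup.cmDatum L 1 (Matrix.of fun i j : Fin 1 => if i.val + j.val + 1 = 1 then (1 : L) else 0)).Local v),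
      MeasurableSpace (((UnitaryGroup.cmDatum L 2 (Matrix.of fun i j : Fin 2 => if i.val + j.val + 1 = 2 then (1 : L) else 0)).Local v × (UnitaryGroup.cmDatum L 1 (Matrix.of fun i j : Fin 1 => if i.val + j.val + 1 = 1 then (1 : L) else 0)).Local v) ⧸ Subgroup.centralizer ({a'} : Set ((UnitaryGroup.cmDatum L 2 (Matrix.of fun i j : Fin 2 => if i.val + j.val + 1 = 2 then (1 : L) else 0)).Local v × (UnitaryGroup.cmDatum L 1 (Matrix.of fun i j : Fin 1 => if i.val + j.val + 1 = 1 then (1 : L) else 0)).Local v))) := fun _ => borel _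
  haveI : ∀ a' : ((UnitaryGroup.cmDatum L 2 (Matrix.of fun i j : Fin 2 => if i.val + j.val + 1 = 2 then (1 : L) else 0)).Local v × (UnitaryGroup.cmDatum L 1 (Matrix.of fun i j : Fin 1 => if i.val + j.val + 1 = 1 then (1 : L) else 0)).Local v),
      BorelSpace (((UnitaryGroup.cmDatum L 2 (Matrix.of fun i j : Fin 2 => if i.val + j.val + 1 = 2 then (1 : L) else 0)).Local v × (UnitaryGroup.cmDatum L 1 (Matrix.of fun i j : Fin 1 => if i.val + j.val + 1 = 1 then (1 : L) else 0)).Local v) ⧸ Subgroup.centralizer ({a'} : Set ((UnitaryGroup.cmDatum L 2 (Matrix.of fun i j : Fin 2 => if i.val + j.val + 1 = 2 then (1 : L) else 0)).Local v × (UnitaryGroup.cmDatum L 1 (Matrix.of fun i j : Fin 1 => if i.val + j.val + 1 = 1 then (1 : L) else 0)).Local v))) := fun _ => ⟨rfl⟩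
  letI : ∀ γ : Gqs L v, MeasurableSpace (Gqs L v ⧸ Subgroup.centralizer ({γ} : Set (Gqs L v))) := fun _ => borel _
  haveI : ∀ γ : Gqs L v, BorelSpace (Gqs L v ⧸ Subgroup.centralizer ({γ} : Set (Gqs L v))) := fun _ => ⟨rfl⟩
  haveI := locallyCompactSpace_cmBorelU L 3 v
  haveI : LocallyCompactSpace (Gqs L v) := locallyCompactSpace_cmDatum_local (L := L) (N := 3) (H := qsForm L) (v := v)
  obtain ⟨w⟩ := (inferInstance : Nonempty (PlacesOver L v))
  have hw : IsCMField.complexConj L • w.1 = w.1 := hns w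
  -- the one-place model at `w`, read on the CM carrier
  set e : ↥(unitaryGroupOfForm (conjLocal L (IsCMField.complexConj L) v) (cmLocalForm L 3 v)) ≃ₜ* ↥(unitaryGroupOfForm (galAdicCompletionMap (L := L) (IsCMField.complexConj L) hw) (placeForm (Rogawski1990.qsForm L) w.1)) :=
    localNonsplitEquiv (IsCMField.complexConj L) (Rogawski1990.qsForm L) (IsCMField.complexConj_ne_one L) w hw with he
  -- the organ's measure-theoretic structures on the model `Gqs L v`, re-read on the (definitionally equal) matrix carrier `U(Φ₃)(L⁺_v)`
  letI mU : MeasurableSpace ↥(unitaryGroupOfForm (conjLocal L (IsCMField.complexConj L) v) (cmLocalForm L 3 v)) := ‹MeasurableSpace (Gqs L v)›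
  haveI : BorelSpace ↥(unitaryGroupOfForm (conjLocal L (IsCMField.complexConj L) v) (cmLocalForm L 3 v)) := ‹BorelSpace (Gqs L v)›
  haveI : (νQv : Measure ↥(unitaryGroupOfForm (conjLocal L (IsCMField.complexConj L) v) (cmLocalForm L 3 v))).IsHaarMeasure := ‹νQv.IsHaarMeasure›
  -- canonical instances on the matrix carrier, pinned once (the generic lemmas of §3 are applied with `@` so that unification with
  -- `cmBorelTriple`∕`ρ` cannot pre-assign instance arguments along a different (defeq) path)
  have iTG : IsTopologicalGroup ↥(unitaryGroupOfForm (conjLocal L (IsCMField.complexConj L) v) (cmLocalForm L 3 v)) := inferInstance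
  have iML : (νQv : Measure ↥(unitaryGroupOfForm (conjLocal L (IsCMField.complexConj L) v) (cmLocalForm L 3 v))).IsMulLeftInvariant := inferInstance
  have iFC : IsFiniteMeasureOnCompacts (νQv : Measure ↥(unitaryGroupOfForm (conjLocal L (IsCMField.complexConj L) v) (cmLocalForm L 3 v))) := inferInstance
  /- STEP 1 — representatives; admissibility (★ N3 on `U(Φ₃)`); `dim V_N ≤ 2` («JDIM2»); eigencharacter multisets («TMULT»). -/
  obtain ⟨rp, rfl⟩ := IrrClass.mk_surjective πp
  obtain ⟨rm, rfl⟩ := IrrClass.mk_surjective πm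
  have hadm : ∀ c : IrrClass (Gqs L v), c.IsAdmissible := fun c =>
    F0P3LocalIrrepAdmissibleOfCuspidal.isAdmissible_irrClass_quasiSplit_of_cuspidal L v
      (F0P3LocalIrrepAdmissibleThree.isSupercuspidal_of_subsingleton_coinvariants L v hns) c
  let ρp : Representation ℂ ↥(unitaryGroupOfForm (conjLocal L (IsCMField.complexConj L) v) (cmLocalForm L 3 v)) rp.V := rp.ρ
  let ρm : Representation ℂ ↥(unitaryGroupOfForm (conjLocal L (IsCMField.complexConj L) v) (cmLocalForm L 3 v)) rm.V := rm.ρ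
  have hap : ρp.IsAdmissible := (IrrClass.isAdmissible_mk rp).1 (hadm _)
  have ham : ρm.IsAdmissible := (IrrClass.isAdmissible_mk rm).1 (hadm _)
  obtain ⟨hfdp, h2p⟩ := F0P3cStCharTSJacquetLine.finrank_coinvariants_le_two L v hns rp
  obtain ⟨hfdm, h2m⟩ := F0P3cStCharTSJacquetLine.finrank_coinvariants_le_two L v hns rm
  have hTcomm : ∀ a b : ↥(cmBorelTriple L 3 v).M, a * b = b * a := fun a b => torusU_mul_comm _ _ a b
  obtain ⟨sp, -, hsp, hfp⟩ := @F0P3cStCharTSTorusMultiset.exists_multiset_of_finrank_le_two _ _ _ _ _ hfdp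
    (ρp.jacquetModule (cmBorelTriple L 3 v)) (fun a b => hTcomm a b) h2p
  obtain ⟨sm, -, hsm, -⟩ := @F0P3cStCharTSTorusMultiset.exists_multiset_of_finrank_le_two _ _ _ _ _ hfdm
    (ρm.jacquetModule (cmBorelTriple L 3 v)) (fun a b => hTcomm a b) h2m
  -- the target eigencharacter `θ_ξ = δ_B^{1/2} · χ_ξ` of `π_N(π²)` (print: `D_G χ^G_ρ = ξμ‖α‖^{1/2}`, p. 195)
  obtain ⟨χξ, hχξ⟩ : ∃ χ : ↥(torusU (conjLocal L (IsCMField.complexConj L) v) (cmLocalForm L 3 v)) →* ℂˣ, χ = (cmXiTorusChar L v (μ.semilocalComponent L v) (torusLocalComponent L (IsCMField.complexConj L) v ξ.η) (torusLocalComponent L (IsCMField.complexConj L) v ξ.ψ)) := ⟨_, rfl⟩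
  obtain ⟨θξ, hθξ⟩ : ∃ θ : ↥(cmBorelTriple L 3 v).M →* ℂˣ,
      θ = ((rootDeltaChar (cmBorelTriple L 3 v).P).comp (Subgroup.inclusion (cmBorelTriple L 3 v).M_le)) * χξ := ⟨_, rfl⟩
  have hθχ : ∀ m : ↥(cmBorelTriple L 3 v).M, θξ m = rootDeltaChar (cmBorelTriple L 3 v).P (Subgroup.inclusion (cmBorelTriple L 3 v).M_le m) * χξ m :=
    fun m => by rw [hθξ, MonoidHom.mul_apply, MonoidHom.comp_apply]
  /- STEP 2 — the subsemigroup `B = Z(G)·{contracting rays}` of `T`; it generates `T` («TORUS-GEN»). -/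
  obtain ⟨B, hBdef⟩ : ∃ B : Subsemigroup ↥(cmBorelTriple L 3 v).M, (B : Set ↥(cmBorelTriple L 3 v).M) =
      {t : ↥(cmBorelTriple L 3 v).M | ∃ z : ↥(unitaryGroupOfForm (conjLocal L (IsCMField.complexConj L) v) (cmLocalForm L 3 v)), z ∈ Subgroup.center ↥(unitaryGroupOfForm (conjLocal L (IsCMField.complexConj L) v) (cmLocalForm L 3 v)) ∧ z ∈ (cmBorelTriple L 3 v).M ∧
        ∃ (a : ↥(torusU (conjLocal L (IsCMField.complexConj L) v) (cmLocalForm L 3 v))) (α : w.1.adicCompletion L), α ≠ 0 ∧ Valued.v α < 1 ∧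
          (((e (a : ↥(unitaryGroupOfForm (conjLocal L (IsCMField.complexConj L) v) (cmLocalForm L 3 v))) : ↥(unitaryGroupOfForm (galAdicCompletionMap (L := L) (IsCMField.complexConj L) hw) (placeForm (Rogawski1990.qsForm L) w.1))) : GL (Fin 3) (w.1.adicCompletion L)) : Matrix (Fin 3) (Fin 3) (w.1.adicCompletion L)) = Matrix.diagonal ![α, 1, ((galAdicCompletionMap (L := L) (IsCMField.complexConj L) hw) α)⁻¹] ∧
          (t : ↥(unitaryGroupOfForm (conjLocal L (IsCMField.complexConj L) v) (cmLocalForm L 3 v))) = z * (a : ↥(unitaryGroupOfForm (conjLocal L (IsCMField.complexConj L) v) (cmLocalForm L 3 v)))} := by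
    refine ⟨{ carrier := _, mul_mem' := ?_ }, rfl⟩
    rintro t₁ t₂ ⟨z₁, hz₁c, hz₁M, a₁, α₁, hα₁0, hα₁1, hE₁, ht₁⟩ ⟨z₂, hz₂c, hz₂M, a₂, α₂, hα₂0, hα₂1, hE₂, ht₂⟩
    refine ⟨z₁ * z₂, Subgroup.mul_mem _ hz₁c hz₂c, Subgroup.mul_mem _ hz₁M hz₂M, a₁ * a₂, α₁ * α₂, mul_ne_zero hα₁0 hα₂0, ?_, ?_, ?_⟩
    · rw [map_mul]; exact mul_lt_one_of_nonneg_of_lt_one_left zero_le hα₁1 hα₂1.le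
    · rw [Subgroup.coe_mul, map_mul, Subgroup.coe_mul, Units.val_mul, hE₁, hE₂, Matrix.diagonal_mul_diagonal, map_mul, mul_inv]
      congr 1
      funext i
      fin_cases i <;> simp
    · show (t₁ : ↥(unitaryGroupOfForm (conjLocal L (IsCMField.complexConj L) v) (cmLocalForm L 3 v))) * (t₂ : ↥(unitaryGroupOfForm (conjLocal L (IsCMField.complexConj L) v) (cmLocalForm L 3 v))) = z₁ * z₂ * ((a₁ : ↥(unitaryGroupOfForm (conjLocal L (IsCMField.complexConj L) v) (cmLocalForm L 3 v))) * (a₂ : ↥(unitaryGroupOfForm (conjLocal L (IsCMField.complexConj L) v) (cmLocalForm L 3 v))))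
      have hc : (a₁ : ↥(unitaryGroupOfForm (conjLocal L (IsCMField.complexConj L) v) (cmLocalForm L 3 v))) * z₂ = z₂ * (a₁ : ↥(unitaryGroupOfForm (conjLocal L (IsCMField.complexConj L) v) (cmLocalForm L 3 v))) := Subgroup.mem_center_iff.1 hz₂c _
      rw [ht₁, ht₂, mul_assoc, mul_assoc, ← mul_assoc (a₁ : ↥(unitaryGroupOfForm (conjLocal L (IsCMField.complexConj L) v) (cmLocalForm L 3 v))) z₂, hc, mul_assoc]
  have hmemB : ∀ t : ↥(cmBorelTriple L 3 v).M, t ∈ B ↔ ∃ z : ↥(unitaryGroupOfForm (conjLocal L (IsCMField.complexConj L) v) (cmLocalForm L 3 v)), z ∈ Subgroup.center ↥(unitaryGroupOfForm (conjLocal L (IsCMField.complexConj L) v) (cmLocalForm L 3 v)) ∧ z ∈ (cmBorelTriple L 3 v).M ∧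
        ∃ (a : ↥(torusU (conjLocal L (IsCMField.complexConj L) v) (cmLocalForm L 3 v))) (α : w.1.adicCompletion L), α ≠ 0 ∧ Valued.v α < 1 ∧
          (((e (a : ↥(unitaryGroupOfForm (conjLocal L (IsCMField.complexConj L) v) (cmLocalForm L 3 v))) : ↥(unitaryGroupOfForm (galAdicCompletionMap (L := L) (IsCMField.complexConj L) hw) (placeForm (Rogawski1990.qsForm L) w.1))) : GL (Fin 3) (w.1.adicCompletion L)) : Matrix (Fin 3) (Fin 3) (w.1.adicCompletion L)) = Matrix.diagonal ![α, 1, ((galAdicCompletionMap (L := L) (IsCMField.complexConj L) hw) α)⁻¹] ∧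
          (t : ↥(unitaryGroupOfForm (conjLocal L (IsCMField.complexConj L) v) (cmLocalForm L 3 v))) = z * (a : ↥(unitaryGroupOfForm (conjLocal L (IsCMField.complexConj L) v) (cmLocalForm L 3 v))) := fun t => by
    rw [← SetLike.mem_coe, hBdef, Set.mem_setOf_eq]
  have hB : Subgroup.closure (B : Set ↥(cmBorelTriple L 3 v).M) = ⊤ := by
    rw [eq_top_iff]
    rintro t -
    obtain ⟨z, a₁, a₂, α₁, α₂, hzc, hzM, hα₁0, hα₁1, hE₁, hα₂0, hα₂1, hE₂, ht⟩ := F0P3cStCharTSShellKit.cm_torus_eq_central_mul_ray_mul_ray_inv L v w hw t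
    have h₁ : (⟨z * (a₁ : ↥(unitaryGroupOfForm (conjLocal L (IsCMField.complexConj L) v) (cmLocalForm L 3 v))), (cmBorelTriple L 3 v).M.mul_mem hzM a₁.2⟩ : ↥(cmBorelTriple L 3 v).M) ∈ B :=
      (hmemB _).2 ⟨z, hzc, hzM, a₁, α₁, hα₁0, hα₁1, hE₁, rfl⟩
    have h₂ : (⟨(a₂ : ↥(unitaryGroupOfForm (conjLocal L (IsCMField.complexConj L) v) (cmLocalForm L 3 v))), a₂.2⟩ : ↥(cmBorelTriple L 3 v).M) ∈ B :=
      (hmemB _).2 ⟨1, Subgroup.one_mem _, Subgroup.one_mem _, a₂, α₂, hα₂0, hα₂1, hE₂, (one_mul _).symm⟩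
    have ht' : t = (⟨z * (a₁ : ↥(unitaryGroupOfForm (conjLocal L (IsCMField.complexConj L) v) (cmLocalForm L 3 v))), (cmBorelTriple L 3 v).M.mul_mem hzM a₁.2⟩ : ↥(cmBorelTriple L 3 v).M) * (⟨(a₂ : ↥(unitaryGroupOfForm (conjLocal L (IsCMField.complexConj L) v) (cmLocalForm L 3 v))), a₂.2⟩ : ↥(cmBorelTriple L 3 v).M)⁻¹ :=
      Subtype.ext ht
    rw [ht']
    exact Subgroup.mul_mem _ (Subgroup.subset_closure h₁) (Subgroup.inv_mem _ (Subgroup.subset_closure h₂))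
  have hne' : ∃ b, b ∈ B := by
    obtain ⟨z, a₁, a₂, α₁, α₂, hzc, hzM, hα₁0, hα₁1, hE₁, -, -, -, -⟩ := F0P3cStCharTSShellKit.cm_torus_eq_central_mul_ray_mul_ray_inv L v w hw 1
    exact ⟨⟨z * (a₁ : ↥(unitaryGroupOfForm (conjLocal L (IsCMField.complexConj L) v) (cmLocalForm L 3 v))), (cmBorelTriple L 3 v).M.mul_mem hzM a₁.2⟩, (hmemB _).2 ⟨z, hzc, hzM, a₁, α₁, hα₁0, hα₁1, hE₁, rfl⟩⟩
  /- STEP 3 — the shell identity on `B`: `Σ_{sp} θ(b) − Σ_{sm} θ(b) = θ_ξ(b)` ((β) at the shell `𝟙_{K_n b K_n}` vs ★ R2d + «LEVEL-DEPTH» + «XIG»). -/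
  have hmain : ∀ b ∈ B, (sp.map fun η : ↥(cmBorelTriple L 3 v).M →* ℂˣ => ((η b : ℂˣ) : ℂ)).sum - (sm.map fun η : ↥(cmBorelTriple L 3 v).M →* ℂˣ => ((η b : ℂˣ) : ℂ)).sum =
      ((θξ b : ℂˣ) : ℂ) := by
    intro b hb
    obtain ⟨z, hzc, hzM, a, α, hα0, hα1, hEa, hba⟩ := (hmemB b).1 hb
    -- (T1) along the ray `a`; `b = z·𝓘.a` is dominant at every level
    obtain ⟨𝓘, K₀, ha𝓘, -, -, -, -, -, haN, haNbar, hexh, -, -, -⟩ :=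
      F0P3CMBorelIwahoriDatum.exists_cmIwahoriDatum L v w hw a hα0 hα1 hEa
    have hE𝓘 : (((e 𝓘.a : ↥(unitaryGroupOfForm (galAdicCompletionMap (L := L) (IsCMField.complexConj L) hw) (placeForm (Rogawski1990.qsForm L) w.1))) : GL (Fin 3) (w.1.adicCompletion L)) : Matrix (Fin 3) (Fin 3) (w.1.adicCompletion L)) = Matrix.diagonal ![α, 1, ((galAdicCompletionMap (L := L) (IsCMField.complexConj L) hw) α)⁻¹] := by
      rw [ha𝓘]; exact hEa
    have hb𝓘 : (b : ↥(unitaryGroupOfForm (conjLocal L (IsCMField.complexConj L) v) (cmLocalForm L 3 v))) = z * 𝓘.a := by rw [ha𝓘]; exact hba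
    have hbM' : z * 𝓘.a ∈ (cmBorelTriple L 3 v).M := (cmBorelTriple L 3 v).M.mul_mem hzM 𝓘.a_mem
    have hbeq : b = ⟨z * 𝓘.a, hbM'⟩ := Subtype.ext hb𝓘
    have hbcomm : ∀ m ∈ (cmBorelTriple L 3 v).M, m * (z * 𝓘.a) = z * 𝓘.a * m := fun m hm =>
      congrArg Subtype.val (hTcomm ⟨m, hm⟩ ⟨z * 𝓘.a, hbM'⟩)
    obtain ⟨hbN, hbNbar, hbexh⟩ := F0P3cStCharTSShellKit.dominant_central_mul (cmBorelTriple L 3 v) 𝓘 hzc haN haNbar hexh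
    -- «XIG» along `(𝓘, z)`; ★ R2d + «LEVEL-DEPTH» for the two members of the support
    obtain ⟨UX, hUX, hX⟩ := hXIG L μ ξ v hns hμu hμω νHv νQv mHv mQv hcH hcQ hTv π₁ πSt hlab hπ₁ 𝓘 z hzc w hw α hα0 hα1 hE𝓘
    obtain ⟨Up, hUp, hAp⟩ := @F0P3cStCharTSShellKit.smoothTrace_shell_eq_mul_sum ↥(unitaryGroupOfForm (conjLocal L (IsCMField.complexConj L) v) (cmLocalForm L 3 v)) inferInstance inferInstance iTG mU inferInstance νQv iML iFC _ _ _ ρp hap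
      (cmBorelTriple L 3 v) (isClosed_cmBorelTriple_N L v) 𝓘 hfdp sp hsp (z * 𝓘.a) hbM' hbcomm hbN hbNbar hbexh
    obtain ⟨Um, hUm, hAm⟩ := @F0P3cStCharTSShellKit.smoothTrace_shell_eq_mul_sum ↥(unitaryGroupOfForm (conjLocal L (IsCMField.complexConj L) v) (cmLocalForm L 3 v)) inferInstance inferInstance iTG mU inferInstance νQv iML iFC _ _ _ ρm ham
      (cmBorelTriple L 3 v) (isClosed_cmBorelTriple_N L v) 𝓘 hfdm sm hsm (z * 𝓘.a) hbM' hbcomm hbN hbNbar hbexh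
    -- one level inside the three depth neighbourhoods; a transversal; the shell is a test function; its transfer (T_v)
    obtain ⟨n, hn⟩ := 𝓘.hasBasis_K (UX ∩ (Up ∩ Um)) (Filter.inter_mem hUX (Filter.inter_mem hUp hUm))
    have hnX : (𝓘.K n : Set ↥(unitaryGroupOfForm (conjLocal L (IsCMField.complexConj L) v) (cmLocalForm L 3 v))) ⊆ UX := hn.trans Set.inter_subset_left
    have hnp : (𝓘.K n : Set ↥(unitaryGroupOfForm (conjLocal L (IsCMField.complexConj L) v) (cmLocalForm L 3 v))) ⊆ Up := hn.trans (Set.inter_subset_right.trans Set.inter_subset_left)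
    have hnm : (𝓘.K n : Set ↥(unitaryGroupOfForm (conjLocal L (IsCMField.complexConj L) v) (cmLocalForm L 3 v))) ⊆ Um := hn.trans (Set.inter_subset_right.trans Set.inter_subset_right)
    have hKo := 𝓘.isOpen_K n
    have hKc := 𝓘.isCompact_K n
    obtain ⟨R, hR⟩ := Representation.exists_isLeftTransversal_conj hKc hKo (z * 𝓘.a)
    have hφ : IsLocSmooth ((DoubleCoset.doubleCoset (z * 𝓘.a) (𝓘.K n : Set ↥(unitaryGroupOfForm (conjLocal L (IsCMField.complexConj L) v) (cmLocalForm L 3 v))) (𝓘.K n)).indicator fun _ => (1 : ℂ)) := by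
      have hc : IsCompact (DoubleCoset.doubleCoset (z * 𝓘.a) (𝓘.K n : Set ↥(unitaryGroupOfForm (conjLocal L (IsCMField.complexConj L) v) (cmLocalForm L 3 v))) (𝓘.K n)) :=
        DoubleCosetIndex.isCompact_doubleCoset hKc _
      refine isLocSmooth_indicator ?_ hc.isClosed hc
      unfold DoubleCoset.doubleCoset
      exact (hKo.mul_right).mul_right
    obtain ⟨fH, hfH, htr⟩ := hTv _ hφ
    -- (β) at `(fH, φ)`: the two-point sum `Tr πp(φ) − Tr πm(φ) = Tr πSt(fH)`
    obtain ⟨-, hsum⟩ := hid fH _ hfH hφ htr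
    rw [F0P3cStCharTSShellKit.tsum_intCast_mul_eq_sub_of_support_pair aX (fun π : IrrClass (Gqs L v) => π.smoothTrace νQv ((DoubleCoset.doubleCoset (z * 𝓘.a) (𝓘.K n : Set ↥(unitaryGroupOfForm (conjLocal L (IsCMField.complexConj L) v) (cmLocalForm L 3 v))) (𝓘.K n)).indicator fun _ => (1 : ℂ))) hne hsupp hp1 hm1] at hsum
    -- «XIG» at `m = 1`
    have hbM1 : z * 𝓘.a ^ 1 ∈ (cmBorelTriple L 3 v).M := by rw [pow_one]; exact hbM'
    have hR1 : IsLeftTransversal (𝓘.K n) (𝓘.K n ⊓ ConjAct.toConjAct (z * 𝓘.a ^ 1) • 𝓘.K n) R := by rw [pow_one]; exact hR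
    have htr1 : IsLocalDeltaTransfer L (qsForm L) v ((finExplicitCollection L (qsForm L) μ (finExplicitDelta_conj_left_all L (qsForm L) μ) (finExplicitDelta_conj_right_all L (qsForm L) μ)) v) mHv mQv fH
        ((DoubleCoset.doubleCoset (z * 𝓘.a ^ 1) (𝓘.K n : Set ↥(unitaryGroupOfForm (conjLocal L (IsCMField.complexConj L) v) (cmLocalForm L 3 v))) (𝓘.K n)).indicator fun _ => (1 : ℂ)) := by
      rw [pow_one]; exact htr
    have hXv := hX n hnX 1 le_rfl hbM1 R hR1 fH hfH htr1
    have hb1 : (⟨z * 𝓘.a ^ 1, hbM1⟩ : ↥(cmBorelTriple L 3 v).M) = ⟨z * 𝓘.a, hbM'⟩ :=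
      Subtype.ext (by show z * 𝓘.a ^ 1 = z * 𝓘.a; rw [pow_one])
    rw [hb1] at hXv
    -- the four values in one currency, and the cancellation of `ν(K_n) · #R ≠ 0`
    have E1 : ρp.smoothTrace νQv ((DoubleCoset.doubleCoset (z * 𝓘.a) (𝓘.K n : Set ↥(unitaryGroupOfForm (conjLocal L (IsCMField.complexConj L) v) (cmLocalForm L 3 v))) (𝓘.K n)).indicator fun _ => (1 : ℂ)) = (νQv.real (𝓘.K n : Set ↥(unitaryGroupOfForm (conjLocal L (IsCMField.complexConj L) v) (cmLocalForm L 3 v))) : ℂ) * (R.card : ℂ) * (sp.map fun η : ↥(cmBorelTriple L 3 v).M →* ℂˣ => ((η ⟨z * 𝓘.a, hbM'⟩ : ℂˣ) : ℂ)).sum := hAp n hnp R hR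
    have E2 : ρm.smoothTrace νQv ((DoubleCoset.doubleCoset (z * 𝓘.a) (𝓘.K n : Set ↥(unitaryGroupOfForm (conjLocal L (IsCMField.complexConj L) v) (cmLocalForm L 3 v))) (𝓘.K n)).indicator fun _ => (1 : ℂ)) = (νQv.real (𝓘.K n : Set ↥(unitaryGroupOfForm (conjLocal L (IsCMField.complexConj L) v) (cmLocalForm L 3 v))) : ℂ) * (R.card : ℂ) * (sm.map fun η : ↥(cmBorelTriple L 3 v).M →* ℂˣ => ((η ⟨z * 𝓘.a, hbM'⟩ : ℂˣ) : ℂ)).sum := hAm n hnm R hR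
    have E3 : ρp.smoothTrace νQv ((DoubleCoset.doubleCoset (z * 𝓘.a) (𝓘.K n : Set ↥(unitaryGroupOfForm (conjLocal L (IsCMField.complexConj L) v) (cmLocalForm L 3 v))) (𝓘.K n)).indicator fun _ => (1 : ℂ)) - ρm.smoothTrace νQv ((DoubleCoset.doubleCoset (z * 𝓘.a) (𝓘.K n : Set ↥(unitaryGroupOfForm (conjLocal L (IsCMField.complexConj L) v) (cmLocalForm L 3 v))) (𝓘.K n)).indicator fun _ => (1 : ℂ)) = πSt.smoothTrace νHv fH := hsum
    have E4 : πSt.smoothTrace νHv fH = (νQv.real (𝓘.K n : Set ↥(unitaryGroupOfForm (conjLocal L (IsCMField.complexConj L) v) (cmLocalForm L 3 v))) : ℂ) * (R.card : ℂ) *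
        ((rootDeltaChar (cmBorelTriple L 3 v).P (Subgroup.inclusion (cmBorelTriple L 3 v).M_le ⟨z * 𝓘.a, hbM'⟩) : ℂˣ) : ℂ) *
          ((χξ ⟨z * 𝓘.a, hbM'⟩ : ℂˣ) : ℂ) := by
      rw [hχξ]; exact hXv
    have hν : (νQv.real (𝓘.K n : Set ↥(unitaryGroupOfForm (conjLocal L (IsCMField.complexConj L) v) (cmLocalForm L 3 v))) : ℂ) * (R.card : ℂ) ≠ 0 := by
      refine mul_ne_zero ?_ (Nat.cast_ne_zero.2 (Finset.card_pos.2 hR.nonempty).ne')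
      -- positivity and finiteness of `ν(K_n)`, read on the model `Gqs L v` (where the organ's Haar instances live)
      have hKoG : IsOpen (X := Gqs L v) (𝓘.K n : Set ↥(unitaryGroupOfForm (conjLocal L (IsCMField.complexConj L) v) (cmLocalForm L 3 v))) := by
        exact hKo
      have hKcG : IsCompact (X := Gqs L v) (𝓘.K n : Set ↥(unitaryGroupOfForm (conjLocal L (IsCMField.complexConj L) v) (cmLocalForm L 3 v))) := by
        exact hKc
      rw [Complex.ofReal_ne_zero]
      exact (ENNReal.toReal_pos (hKoG.measure_pos νQv ⟨1, (𝓘.K n).one_mem⟩).ne' (hKcG.measure_lt_top (μ := νQv)).ne).ne'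
    have E5 : (νQv.real (𝓘.K n : Set ↥(unitaryGroupOfForm (conjLocal L (IsCMField.complexConj L) v) (cmLocalForm L 3 v))) : ℂ) * (R.card : ℂ) * ((sp.map fun η : ↥(cmBorelTriple L 3 v).M →* ℂˣ => ((η ⟨z * 𝓘.a, hbM'⟩ : ℂˣ) : ℂ)).sum - (sm.map fun η : ↥(cmBorelTriple L 3 v).M →* ℂˣ => ((η ⟨z * 𝓘.a, hbM'⟩ : ℂˣ) : ℂ)).sum) = (νQv.real (𝓘.K n : Set ↥(unitaryGroupOfForm (conjLocal L (IsCMField.complexConj L) v) (cmLocalForm L 3 v))) : ℂ) * (R.card : ℂ) * ((θξ ⟨z * 𝓘.a, hbM'⟩ : ℂˣ) : ℂ) := by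
      rw [mul_sub, ← E1, ← E2, E3, E4, hθχ, Units.val_mul, mul_assoc]
    rw [hbeq]
    exact mul_left_cancel₀ hν E5
  /- STEP 4 — Artin («ARTIN-B», via §1): `θ_ξ ∈ sp`; its quotient functional («TMULT») is a non-zero `T`-map `r_B(πp) → ℂ_{χ_ξ}` (§3);
     Frobenius + Keys («PI2-ID»): `πp = π²`. -/
  have hθs : θξ ∈ sp := F0P3cStCharTSShellKit.mem_of_forall_sum_sub_sum_eq B hB hne' sp sm θξ hmain
  obtain ⟨ψ₀, hψ₀, hψeq⟩ := hfp θξ hθs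
  obtain ⟨Ψ, hΨ⟩ := @F0P3cStCharTSShellKit.exists_intertwiningMap_twist_of_functional ↥(unitaryGroupOfForm (conjLocal L (IsCMField.complexConj L) v) (cmLocalForm L 3 v)) inferInstance inferInstance iTG _ _ _ ρp (cmBorelTriple L 3 v)
    (locallyCompactSpace_cmBorelU L 3 v) θξ χξ hθχ ψ₀ hψ₀ hψeq
  have hL2p : (IrrClass.mk rp).IsSquareIntegrable μZ := hsq _ (by rw [hp1]; exact one_ne_zero)
  have hid2 := F0P3cStCharTSPi2Id.eq_pi2_of_isSquareIntegrable_of_quotientCharacter L v hns (μ.semilocalComponent L v)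
    (torusLocalComponent L (IsCMField.complexConj L) v ξ.η) (torusLocalComponent L (IsCMField.complexConj L) v ξ.ψ) μZ hK hL2 rp hL2p χξ
    (Or.inl hχξ) Ψ hΨ
  rw [← hid2]
  exact hp1

end Organ

end Summit.HodgeConjecture.HodgeConjecture.Cruxes.H413.F0P3cStCharTSNoncuspidalOfXIG

end
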